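import Summits.Ventures.Crystal3D.Theorems.StickyWulffConstantCoaxialWallLawEndGap
import Summits.Ventures.Crystal3D.Theorems.StickyWulffConstantGenericWallFloorDozenStep
import HarnessLib

/-!
# End accounting for the word automaton, census-free: a reachable END is unsaturated or has two unsaturated contact neighbours

HONEST FRAMING. Part of the venture `Summits/Ventures/Crystal3D` (cell `crystal3d-full`), helper for the crux
`CoaxialWallLaw` (stmt-Ventures-19481) of `route-Ventures-StickyWulffConstant`, REGISTERED line `WallLedgerF`
(planner cf-p1), open stub `stub_coaxialTwoSlabAdhesion` (general fillings).  Rung credit only; F-C1 not moved.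

WHY THIS FILE.  `…CoaxialWallLawEndCharge.word_reachable_end_le_eleven` charged every reachable end of the word
automaton to its OWN ball through two E1 rows BY NAME: C12-55 (`hcert`, the closed polar star) and the A12 GLIDE
STAR (`hcertA`).  The second row is FALSE: the cell's literature seat found an exact kissing dozen containing the
glide star that is not close-packed (`…GenericWallFloorGlideStarWitness.not_exactOnly_glideStar583`, lit g13,
2026-08-28), so every file carrying `hcertA` is conditional on a false hypothesis.  This file replaces the row by
the census-free DOZEN STEP of 19480-p1 (`…GenericWallFloorDozenStep.fullShell_or_twinDozen_of_allButOne`, inputs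
`KissingGap δ`, `KissingClassification δ` BY NAME) — planner cf-p1's option (A), INBOX 2026-08-28T04:19:27Z:

* **`word_reachable_end_dichotomy`** — a state `f v` reached from a MOVING state `v ∈ W` that is itself NOT
  moving (an END: full, cross OR glide target alike) has at most ELEVEN contacts, OR, for every ball `y₀`, a
  contact neighbour `z ≠ y₀` with at most eleven contacts (so at least TWO such neighbours).  Proof: the target is a
  certified state (three occupied slots of its frame at mutual inner product `½`, `word_move_target`); if it and
  all its contact neighbours but at most one were saturated, the dozen step would make its neighbourhood the full
  slot shell — a FULL reading — or a twin dozen across a unit menu normal `n` with the empty far slots on the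
  positive side — a TWIN reading, because the predecessor `b − d κ = b + F κ (−u)` is occupied, whence
  `⟪F κ u, n⟫ ≥ 0`, i.e. `∈ {0, √(2/3)}`; either way the end would be moving.
* `word_reachable_end_two_payers` — the same packaged as: `≤ 11` contacts, or two DISTINCT contact neighbours
  with `≤ 11` contacts.

NO `ExactOnly` row is used (not even C12-55).  The crude census-free count (ends at saturated balls charged to
their unsaturated neighbours) is the next brick.

WHAT THIS IS NOT: not the stub; not a multiplicity bound; F-C1 not moved.
-/

noncomputable section

namespace Summit.Ventures.Crystal3D.Theorems

open Summit.Ventures.Crystal3D Finset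
open Literature.MathematicalPhysics.StatisticalMechanics (fccStacking)
open scoped InnerProductSpace

variable {X : Finset (EuclideanSpace ℝ (Fin 3))}

section Word

variable {K : Type*} {F : K → (EuclideanSpace ℝ (Fin 3) ≃ₗᵢ[ℝ] EuclideanSpace ℝ (Fin 3))}
  {d : K → EuclideanSpace ℝ (Fin 3)} {next : K → EuclideanSpace ℝ (Fin 3) → K}
  {W : Finset (EuclideanSpace ℝ (Fin 3) × K)}
  {f : EuclideanSpace ℝ (Fin 3) × K → EuclideanSpace ℝ (Fin 3) × K}

open scoped Classical in
/-- **A reachable END is unsaturated or has, past any one ball, an unsaturated contact neighbour** (census-free;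
`KissingGap δ`, `KissingClassification δ` BY NAME).  See the module docstring. -/
theorem word_reachable_end_dichotomy {δ : ℝ} (hg : KissingGap δ) (hc : KissingClassification δ)
    (hX : ∀ p ∈ X, ∀ q ∈ X, p ≠ q → 1 ≤ dist p q)
    (hd : ∀ κ, ∃ u ∈ fccSlots, d κ = F κ u)
    (hdn : ∀ κ, ∃ m : EuclideanSpace ℝ (Fin 3), ‖m‖ = 1 ∧
      (∀ w ∈ fccSlots, ⟪F κ w, m⟫_ℝ = 0 ∨ ⟪F κ w, m⟫_ℝ = Real.sqrt (2 / 3) ∨ ⟪F κ w, m⟫_ℝ = -Real.sqrt (2 / 3)) ∧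
      ⟪d κ, m⟫_ℝ = Real.sqrt (2 / 3))
    (hmirror : ∀ κ (m : EuclideanSpace ℝ (Fin 3)), ‖m‖ = 1 →
      (∀ w ∈ fccSlots, ⟪F κ w, m⟫_ℝ = 0 ∨ ⟪F κ w, m⟫_ℝ = Real.sqrt (2 / 3) ∨ ⟪F κ w, m⟫_ℝ = -Real.sqrt (2 / 3)) →
      ⟪d κ, m⟫_ℝ = Real.sqrt (2 / 3) → ∀ x, F (next κ m) x = F κ x - (2 * ⟪F κ x, m⟫_ℝ) • m)
    (hdnext : ∀ κ (m : EuclideanSpace ℝ (Fin 3)), ‖m‖ = 1 →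
      (∀ w ∈ fccSlots, ⟪F κ w, m⟫_ℝ = 0 ∨ ⟪F κ w, m⟫_ℝ = Real.sqrt (2 / 3) ∨ ⟪F κ w, m⟫_ℝ = -Real.sqrt (2 / 3)) →
      ⟪d κ, m⟫_ℝ = Real.sqrt (2 / 3) → ⟪d (next κ m), m⟫_ℝ = Real.sqrt (2 / 3))
    (hW : ∀ v, v ∈ W ↔ (v.1 ∈ X ∧
      (∃ a ∈ fccSlots, ∃ a' ∈ fccSlots, ∃ a'' ∈ fccSlots,
        ⟪a, a'⟫_ℝ = 1 / 2 ∧ ⟪a, a''⟫_ℝ = 1 / 2 ∧ ⟪a', a''⟫_ℝ = 1 / 2 ∧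
        v.1 + F v.2 a ∈ X ∧ v.1 + F v.2 a' ∈ X ∧ v.1 + F v.2 a'' ∈ X) ∧
      v.1 - d v.2 ∈ X))
    (hf_full : ∀ v ∈ W, (∀ w ∈ fccSlots, v.1 + F v.2 w ∈ X) → f v = (v.1 + d v.2, v.2))
    (hf_cross : ∀ v ∈ W, ∀ m : EuclideanSpace ℝ (Fin 3), ‖m‖ = 1 →
      (∀ w ∈ fccSlots, ⟪F v.2 w, m⟫_ℝ = 0 ∨ ⟪F v.2 w, m⟫_ℝ = Real.sqrt (2 / 3) ∨ ⟪F v.2 w, m⟫_ℝ = -Real.sqrt (2 / 3)) →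
      (∀ w ∈ fccSlots, ⟪F v.2 w, m⟫_ℝ ≤ 0 → v.1 + F v.2 w ∈ X) →
      (∀ w ∈ fccSlots, ⟪F v.2 w, m⟫_ℝ < 0 → v.1 + (F v.2 w - (2 * ⟪F v.2 w, m⟫_ℝ) • m) ∈ X) →
      (∀ w ∈ fccSlots, 0 < ⟪F v.2 w, m⟫_ℝ → v.1 + F v.2 w ∉ X) →
      ⟪d v.2, m⟫_ℝ = Real.sqrt (2 / 3) → f v = (v.1 + d (next v.2 m), next v.2 m))
    (hf_glide : ∀ v ∈ W, ∀ m : EuclideanSpace ℝ (Fin 3), ‖m‖ = 1 →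
      (∀ w ∈ fccSlots, ⟪F v.2 w, m⟫_ℝ = 0 ∨ ⟪F v.2 w, m⟫_ℝ = Real.sqrt (2 / 3) ∨ ⟪F v.2 w, m⟫_ℝ = -Real.sqrt (2 / 3)) →
      (∀ w ∈ fccSlots, ⟪F v.2 w, m⟫_ℝ ≤ 0 → v.1 + F v.2 w ∈ X) →
      (∀ w ∈ fccSlots, ⟪F v.2 w, m⟫_ℝ < 0 → v.1 + (F v.2 w - (2 * ⟪F v.2 w, m⟫_ℝ) • m) ∈ X) →
      (∀ w ∈ fccSlots, 0 < ⟪F v.2 w, m⟫_ℝ → v.1 + F v.2 w ∉ X) →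
      ⟪d v.2, m⟫_ℝ = 0 → f v = (v.1 + d v.2, v.2))
    {v : EuclideanSpace ℝ (Fin 3) × K} (hv : v ∈ W)
    (hmov : (∀ w ∈ fccSlots, v.1 + F v.2 w ∈ X) ∨
      ∃ m : EuclideanSpace ℝ (Fin 3), ‖m‖ = 1 ∧
        (∀ w ∈ fccSlots, ⟪F v.2 w, m⟫_ℝ = 0 ∨ ⟪F v.2 w, m⟫_ℝ = Real.sqrt (2 / 3) ∨ ⟪F v.2 w, m⟫_ℝ = -Real.sqrt (2 / 3)) ∧
        (∀ w ∈ fccSlots, ⟪F v.2 w, m⟫_ℝ ≤ 0 → v.1 + F v.2 w ∈ X) ∧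
        (∀ w ∈ fccSlots, ⟪F v.2 w, m⟫_ℝ < 0 → v.1 + (F v.2 w - (2 * ⟪F v.2 w, m⟫_ℝ) • m) ∈ X) ∧
        (∀ w ∈ fccSlots, 0 < ⟪F v.2 w, m⟫_ℝ → v.1 + F v.2 w ∉ X) ∧
        (⟪d v.2, m⟫_ℝ = Real.sqrt (2 / 3) ∨ ⟪d v.2, m⟫_ℝ = 0))
    (hend : ¬ ((∀ w ∈ fccSlots, (f v).1 + F (f v).2 w ∈ X) ∨
      ∃ m : EuclideanSpace ℝ (Fin 3), ‖m‖ = 1 ∧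
        (∀ w ∈ fccSlots, ⟪F (f v).2 w, m⟫_ℝ = 0 ∨ ⟪F (f v).2 w, m⟫_ℝ = Real.sqrt (2 / 3) ∨
          ⟪F (f v).2 w, m⟫_ℝ = -Real.sqrt (2 / 3)) ∧
        (∀ w ∈ fccSlots, ⟪F (f v).2 w, m⟫_ℝ ≤ 0 → (f v).1 + F (f v).2 w ∈ X) ∧
        (∀ w ∈ fccSlots, ⟪F (f v).2 w, m⟫_ℝ < 0 → (f v).1 + (F (f v).2 w - (2 * ⟪F (f v).2 w, m⟫_ℝ) • m) ∈ X) ∧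
        (∀ w ∈ fccSlots, 0 < ⟪F (f v).2 w, m⟫_ℝ → (f v).1 + F (f v).2 w ∉ X) ∧
        (⟪d (f v).2, m⟫_ℝ = Real.sqrt (2 / 3) ∨ ⟪d (f v).2, m⟫_ℝ = 0)))
    (y₀ : EuclideanSpace ℝ (Fin 3)) :
    (X.filter fun q => dist (f v).1 q = 1).card ≤ 11 ∨
      ∃ z ∈ X, dist (f v).1 z = 1 ∧ z ≠ y₀ ∧ (X.filter fun q => dist z q = 1).card ≤ 11 := by
  have hr : 0 < Real.sqrt (2 / 3) := Real.sqrt_pos.2 (by norm_num)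
  -- the target is a certified state: three independent occupied slots and the predecessor
  obtain ⟨hfvW, -, -⟩ := word_move_target hd hdn hmirror hdnext hW hf_full hf_cross hf_glide hv hmov
  obtain ⟨-, ⟨a, ha, a', ha', a'', ha'', i1, i2, i3, h1, h2, h3⟩, hpred⟩ := (hW _).1 hfvW
  have hind : LinearIndependent ℝ ![a, a', a''] := linearIndependent_of_pairwise_half ha ha' ha'' i1 i2 i3
  by_contra hcon
  push Not at hcon
  obtain ⟨h11, hnb⟩ := hcon
  have h12 : (X.filter fun q => dist (f v).1 q = 1).card = 12 :=
    le_antisymm (card_filter_dist_eq_one_le_twelve X hX _) (by omega)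
  have hnb' : ∀ z ∈ X, dist (f v).1 z = 1 → z ≠ y₀ → (X.filter fun q => dist z q = 1).card = 12 := by
    intro z hz hdz hne
    exact le_antisymm (card_filter_dist_eq_one_le_twelve X hX _) (by have := hnb z hz hdz hne; omega)
  -- the dozen step in the target's own frame
  rcases fullShell_or_twinDozen_of_allButOne hg hc hX h12 y₀ hnb' (F (f v).2) ha ha' ha'' hind h1 h2 h3 with
    hfull | ⟨n, hn, hmenu, hown, hmir, hfar, -, -, -⟩
  · exact hend (Or.inl hfull)
  · -- the predecessor occupies slot `−u`, so the direction is on the closed positive side of `n`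
    obtain ⟨u, hu, hdu⟩ := hd (f v).2
    have hnu : -u ∈ fccSlots := neg_mem_fccSlots hu
    have hle : ⟪F (f v).2 (-u), n⟫_ℝ ≤ 0 := by
      by_contra hpos
      push Not at hpos
      apply hfar (-u) hnu hpos
      have : (f v).1 + F (f v).2 (-u) = (f v).1 - d (f v).2 := by rw [map_neg, hdu, sub_eq_add_neg]
      rw [this]; exact hpred
    have hge : 0 ≤ ⟪d (f v).2, n⟫_ℝ := by
      rw [hdu]; rw [map_neg, inner_neg_left] at hle; linarith
    have hdir : ⟪d (f v).2, n⟫_ℝ = Real.sqrt (2 / 3) ∨ ⟪d (f v).2, n⟫_ℝ = 0 := by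
      rcases hmenu u hu with h0 | h0 | h0
      · exact Or.inr (by rw [hdu]; exact h0)
      · exact Or.inl (by rw [hdu]; exact h0)
      · exfalso; rw [hdu] at hge; rw [h0] at hge; linarith
    exact hend (Or.inr ⟨n, hn, hmenu, hown, hmir, hfar, hdir⟩)

open scoped Classical in
/-- **A reachable END is unsaturated or has two DISTINCT unsaturated contact neighbours** (census-free).  See the
module docstring. -/
theorem word_reachable_end_two_payers {δ : ℝ} (hg : KissingGap δ) (hc : KissingClassification δ)
    (hX : ∀ p ∈ X, ∀ q ∈ X, p ≠ q → 1 ≤ dist p q)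
    (hd : ∀ κ, ∃ u ∈ fccSlots, d κ = F κ u)
    (hdn : ∀ κ, ∃ m : EuclideanSpace ℝ (Fin 3), ‖m‖ = 1 ∧
      (∀ w ∈ fccSlots, ⟪F κ w, m⟫_ℝ = 0 ∨ ⟪F κ w, m⟫_ℝ = Real.sqrt (2 / 3) ∨ ⟪F κ w, m⟫_ℝ = -Real.sqrt (2 / 3)) ∧
      ⟪d κ, m⟫_ℝ = Real.sqrt (2 / 3))
    (hmirror : ∀ κ (m : EuclideanSpace ℝ (Fin 3)), ‖m‖ = 1 →
      (∀ w ∈ fccSlots, ⟪F κ w, m⟫_ℝ = 0 ∨ ⟪F κ w, m⟫_ℝ = Real.sqrt (2 / 3) ∨ ⟪F κ w, m⟫_ℝ = -Real.sqrt (2 / 3)) →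
      ⟪d κ, m⟫_ℝ = Real.sqrt (2 / 3) → ∀ x, F (next κ m) x = F κ x - (2 * ⟪F κ x, m⟫_ℝ) • m)
    (hdnext : ∀ κ (m : EuclideanSpace ℝ (Fin 3)), ‖m‖ = 1 →
      (∀ w ∈ fccSlots, ⟪F κ w, m⟫_ℝ = 0 ∨ ⟪F κ w, m⟫_ℝ = Real.sqrt (2 / 3) ∨ ⟪F κ w, m⟫_ℝ = -Real.sqrt (2 / 3)) →
      ⟪d κ, m⟫_ℝ = Real.sqrt (2 / 3) → ⟪d (next κ m), m⟫_ℝ = Real.sqrt (2 / 3))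
    (hW : ∀ v, v ∈ W ↔ (v.1 ∈ X ∧
      (∃ a ∈ fccSlots, ∃ a' ∈ fccSlots, ∃ a'' ∈ fccSlots,
        ⟪a, a'⟫_ℝ = 1 / 2 ∧ ⟪a, a''⟫_ℝ = 1 / 2 ∧ ⟪a', a''⟫_ℝ = 1 / 2 ∧
        v.1 + F v.2 a ∈ X ∧ v.1 + F v.2 a' ∈ X ∧ v.1 + F v.2 a'' ∈ X) ∧
      v.1 - d v.2 ∈ X))
    (hf_full : ∀ v ∈ W, (∀ w ∈ fccSlots, v.1 + F v.2 w ∈ X) → f v = (v.1 + d v.2, v.2))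
    (hf_cross : ∀ v ∈ W, ∀ m : EuclideanSpace ℝ (Fin 3), ‖m‖ = 1 →
      (∀ w ∈ fccSlots, ⟪F v.2 w, m⟫_ℝ = 0 ∨ ⟪F v.2 w, m⟫_ℝ = Real.sqrt (2 / 3) ∨ ⟪F v.2 w, m⟫_ℝ = -Real.sqrt (2 / 3)) →
      (∀ w ∈ fccSlots, ⟪F v.2 w, m⟫_ℝ ≤ 0 → v.1 + F v.2 w ∈ X) →
      (∀ w ∈ fccSlots, ⟪F v.2 w, m⟫_ℝ < 0 → v.1 + (F v.2 w - (2 * ⟪F v.2 w, m⟫_ℝ) • m) ∈ X) →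
      (∀ w ∈ fccSlots, 0 < ⟪F v.2 w, m⟫_ℝ → v.1 + F v.2 w ∉ X) →
      ⟪d v.2, m⟫_ℝ = Real.sqrt (2 / 3) → f v = (v.1 + d (next v.2 m), next v.2 m))
    (hf_glide : ∀ v ∈ W, ∀ m : EuclideanSpace ℝ (Fin 3), ‖m‖ = 1 →
      (∀ w ∈ fccSlots, ⟪F v.2 w, m⟫_ℝ = 0 ∨ ⟪F v.2 w, m⟫_ℝ = Real.sqrt (2 / 3) ∨ ⟪F v.2 w, m⟫_ℝ = -Real.sqrt (2 / 3)) →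
      (∀ w ∈ fccSlots, ⟪F v.2 w, m⟫_ℝ ≤ 0 → v.1 + F v.2 w ∈ X) →
      (∀ w ∈ fccSlots, ⟪F v.2 w, m⟫_ℝ < 0 → v.1 + (F v.2 w - (2 * ⟪F v.2 w, m⟫_ℝ) • m) ∈ X) →
      (∀ w ∈ fccSlots, 0 < ⟪F v.2 w, m⟫_ℝ → v.1 + F v.2 w ∉ X) →
      ⟪d v.2, m⟫_ℝ = 0 → f v = (v.1 + d v.2, v.2))
    {v : EuclideanSpace ℝ (Fin 3) × K} (hv : v ∈ W)
    (hmov : (∀ w ∈ fccSlots, v.1 + F v.2 w ∈ X) ∨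
      ∃ m : EuclideanSpace ℝ (Fin 3), ‖m‖ = 1 ∧
        (∀ w ∈ fccSlots, ⟪F v.2 w, m⟫_ℝ = 0 ∨ ⟪F v.2 w, m⟫_ℝ = Real.sqrt (2 / 3) ∨ ⟪F v.2 w, m⟫_ℝ = -Real.sqrt (2 / 3)) ∧
        (∀ w ∈ fccSlots, ⟪F v.2 w, m⟫_ℝ ≤ 0 → v.1 + F v.2 w ∈ X) ∧
        (∀ w ∈ fccSlots, ⟪F v.2 w, m⟫_ℝ < 0 → v.1 + (F v.2 w - (2 * ⟪F v.2 w, m⟫_ℝ) • m) ∈ X) ∧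
        (∀ w ∈ fccSlots, 0 < ⟪F v.2 w, m⟫_ℝ → v.1 + F v.2 w ∉ X) ∧
        (⟪d v.2, m⟫_ℝ = Real.sqrt (2 / 3) ∨ ⟪d v.2, m⟫_ℝ = 0))
    (hend : ¬ ((∀ w ∈ fccSlots, (f v).1 + F (f v).2 w ∈ X) ∨
      ∃ m : EuclideanSpace ℝ (Fin 3), ‖m‖ = 1 ∧
        (∀ w ∈ fccSlots, ⟪F (f v).2 w, m⟫_ℝ = 0 ∨ ⟪F (f v).2 w, m⟫_ℝ = Real.sqrt (2 / 3) ∨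
          ⟪F (f v).2 w, m⟫_ℝ = -Real.sqrt (2 / 3)) ∧
        (∀ w ∈ fccSlots, ⟪F (f v).2 w, m⟫_ℝ ≤ 0 → (f v).1 + F (f v).2 w ∈ X) ∧
        (∀ w ∈ fccSlots, ⟪F (f v).2 w, m⟫_ℝ < 0 → (f v).1 + (F (f v).2 w - (2 * ⟪F (f v).2 w, m⟫_ℝ) • m) ∈ X) ∧
        (∀ w ∈ fccSlots, 0 < ⟪F (f v).2 w, m⟫_ℝ → (f v).1 + F (f v).2 w ∉ X) ∧
        (⟪d (f v).2, m⟫_ℝ = Real.sqrt (2 / 3) ∨ ⟪d (f v).2, m⟫_ℝ = 0))) :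
    (X.filter fun q => dist (f v).1 q = 1).card ≤ 11 ∨
      ∃ z₁ ∈ X, ∃ z₂ ∈ X, z₁ ≠ z₂ ∧ dist (f v).1 z₁ = 1 ∧ dist (f v).1 z₂ = 1 ∧
        (X.filter fun q => dist z₁ q = 1).card ≤ 11 ∧ (X.filter fun q => dist z₂ q = 1).card ≤ 11 := by
  rcases word_reachable_end_dichotomy hg hc hX hd hdn hmirror hdnext hW hf_full hf_cross hf_glide hv hmov hend
      (f v).1 with h11 | ⟨z₁, hz₁, hd₁, -, hc₁⟩
  · exact Or.inl h11
  rcases word_reachable_end_dichotomy hg hc hX hd hdn hmirror hdnext hW hf_full hf_cross hf_glide hv hmov hend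
      z₁ with h11 | ⟨z₂, hz₂, hd₂, hne, hc₂⟩
  · exact Or.inl h11
  exact Or.inr ⟨z₁, hz₁, z₂, hz₂, fun h => hne (h ▸ rfl), hd₁, hd₂, hc₁, hc₂⟩

end Word

end Summit.Ventures.Crystal3D.Theorems

end
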